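import Literature.Probability.LatticeModels.KCFamilyLimits
import Literature.Probability.LatticeModels.LatticeToContinuumPrimitive
import Literature.Probability.LatticeModels.KCPrimitiveIncrement
import HarnessLib

/-!
# The primitives `H_δ` of the spin fermion along a nice family: increments converge to `-κ Im ∫ g²`

Topic `Literature/Probability/LatticeModels`. Chelkak–Hongler–Izyurov 2015, §3.5: along a
subsequence with `ϑ(δ)^{-1} F_δ → f̃` uniformly on compacts, "`H_δ → h̃ := Re ∫ f̃²` uniformly on
compact subsets of `Ω ∖ {a}`". Tree form for a nice family of Kadanoff–Ceva data
(`KCFamilyBounds.lean`) and the plain branch on the slit domain `Ω ∖ seamRay a`: if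
`δ_k^{-1/2} F_{δ_k} → g` uniformly on a compact neighbourhood `K ⊆ Ω ∖ seamRay a` of a rectangle with
ordered corners `z, w`, then the increment of `Hw_{δ_k}` along the lattice staircase from the site
nearest to `z` to the grid vertex nearest to `w` converges to
`-κ Im(∫_{z.re}^{w.re} g²(x + i z.im) dx + i ∫_{z.im}^{w.im} g²(w.re + i y) dy)`, `κ = 1/(√2 c_KC)`
(`KCFamily.IsNice.tendsto_hw_staircase`) — by the observable-independent
`tendsto_staircase_of_increments` fed with the white increment formula
(`IsKCPrimitive.hw_increment_kcObs`) and the static estimates of `KCFamilyLimits.lean`.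
Everything is proved; no named fact.

## References

* D. Chelkak, C. Hongler, K. Izyurov, Ann. of Math. 181 (2015), Prop. 3.6 and §3.5
  [ChelkakHonglerIzyurovAnnals2015].
* S. Smirnov, Ann. of Math. 172 (2010), Remark 3.7 and §5 [Smirnov2010].
-/

noncomputable section

namespace Literature.Probability.LatticeModels

open Filter _root_.Topology Metric Set Finset Complex SimpleGraph

namespace KCFamily

variable {𝓕 : KCFamily} {Ω : Set ℂ} {a : ℂ}

/-- **The white increment formula near a compact off `a`**, eventually in the mesh: at every site
with mesh point in `K` and every direction. [cite: Smirnov2010, Remark 3.7; ChelkakHonglerIzyurovAnnals2015, Prop. 3.6] -/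
theorem IsNice.hw_increment_near (h : 𝓕.IsNice Ω a) {K : Set ℂ} (hK : IsCompact K) (hKa : K ⊆ Ω \ {a}) :
    ∀ᶠ δ in 𝓝[>] (0 : ℝ), ∀ y : Site 2, meshPoint δ y ∈ K → ∀ e : Fin 4,
      𝓕.Hw δ (y + cornerUnit e) - 𝓕.Hw δ y =
        -(1 / (Real.sqrt 2 * kcFluxConst)) * (I ^ (e : ℕ) * ((1 : ℂ) * 𝓕.obs Ω δ (cSrc (y, e))) ^ 2).im := by
  obtain ⟨ρ, hρ, hbulk⟩ := h.bulk K hKa hK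
  have hsmall : ∀ᶠ δ in 𝓝[>] (0 : ℝ), δ < ρ / 8 := nhdsWithin_le_nhds (Iio_mem_nhds (by positivity))
  have h3 : ∀ᶠ δ in 𝓝[>] (0 : ℝ), 0 < δ := self_mem_nhdsWithin
  filter_upwards [h.adj, h.cuts, h.prim, hbulk, hsmall, h3] with δ hadj hcuts hprim hb hδs hδ0 y hy e
  have hnear : ∀ y' ∈ latticeBall y 3, dist (meshPoint δ y') (meshPoint δ y) ≤ ρ := by
    intro y' hy'
    have := dist_meshPoint_le_of_mem_latticeBall hδ0.le hy'
    push_cast at this; linarith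
  have hy0 : y ∈ latticeBall y 0 := by rw [mem_latticeBall]; intro i; constructor <;> linarith
  have m1 : y + cornerUnit e ∈ latticeBall y 3 := latticeBall_subset (by norm_num) (add_cornerUnit_mem_latticeBall hy0 e)
  have m2 : y + cornerUnit e + cornerUnit 2 ∈ latticeBall y 3 :=
    latticeBall_subset (by norm_num) (add_cornerUnit_mem_latticeBall (add_cornerUnit_mem_latticeBall hy0 e) 2)
  have m3 : y + cornerUnit e + cornerUnit 3 ∈ latticeBall y 3 :=
    latticeBall_subset (by norm_num) (add_cornerUnit_mem_latticeBall (add_cornerUnit_mem_latticeBall hy0 e) 3)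
  have hyb := hb y y hy (hnear y (latticeBall_subset (by norm_num) hy0))
  exact hprim.hw_increment_kcObs hcuts hadj (discreteDomainGraph_le_zdGraph Ω δ) e (hyb.2.2.1 e) (hb y _ hy (hnear _ m1)).1
    (hb y _ hy (hnear _ m2)).1 (hb y _ hy (hnear _ m3)).1 (hb y _ hy (hnear _ m1)).2.2.1

/-- **Increments of `H_δ` converge to `-κ Im ∫ g²`** along a sequence of meshes on which the plain
branch converges: for a rectangle with ordered corners whose `r`-neighbourhood `K` lies in the slit
domain, and `δ_k^{-1/2} F_{δ_k} → g` uniformly on `K`. [cite: ChelkakHonglerIzyurovAnnals2015, §3.5 (H_δ → Re∫f̃²)] -/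
theorem IsNice.tendsto_hw_staircase (h : 𝓕.IsNice Ω a) (hΩ : IsOpen Ω) {s : ℕ → ℝ} (hs : Tendsto s atTop (𝓝[>] (0 : ℝ)))
    {g : ℂ → ℂ} {z w : ℂ} (hre : z.re ≤ w.re) (him : z.im ≤ w.im)
    {K : Set ℂ} (hK : IsCompact K) (hKΩ : K ⊆ Ω \ seamRay a) (hg : ContinuousOn g K) {r : ℝ} (hr : 0 < r)
    (hKR : cthickening r (Rectangle z w) ⊆ K)
    (hconv : TendstoUniformlyOn (scaledEdgeFamily (𝓕.obs Ω) s) g atTop K) :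
    Tendsto (fun k => 𝓕.Hw (s k) (vtx (nearestSite (s k) z) (⌊(w.re - z.re) / s k⌋₊) (⌊(w.im - z.im) / s k⌋₊)) -
        𝓕.Hw (s k) (nearestSite (s k) z)) atTop
      (𝓝 (-(1 / (Real.sqrt 2 * kcFluxConst)) * ((1 : ℂ) ^ 2 * ((∫ x : ℝ in z.re..w.re, g (x + z.im * I) ^ 2) +
          I * ∫ y : ℝ in z.im..w.im, g (w.re + y * I) ^ 2)).im)) := by
  have hKa : K ⊆ Ω \ {a} := fun z hz => ⟨(hKΩ hz).1, fun hza => (hKΩ hz).2 (hza ▸ mem_seamRay_self a)⟩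
  obtain ⟨L, -, hcross⟩ := h.exists_cross_bound hΩ hK hKΩ
  obtain ⟨M, -, hM⟩ := h.exists_sqrt_bound hΩ hK hKΩ
  have hincr := h.hw_increment_near hK hKa
  have hsmall : ∀ᶠ δ in 𝓝[>] (0 : ℝ), δ < r / 3 := nhdsWithin_le_nhds (Iio_mem_nhds (by positivity))
  have hall := hs.eventually (((hcross.and hM).and hincr).and (hsmall.and (self_mem_nhdsWithin : ∀ᶠ δ in 𝓝[>] (0 : ℝ), 0 < δ)))
  obtain ⟨k₀, hk₀⟩ := eventually_atTop.1 hall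
  set s' : ℕ → ℝ := fun k => s (k + k₀) with hs'
  have hk : ∀ k, (((∀ x : Site 2, meshPoint (s' k) x ∈ K →
        ‖𝓕.obs Ω (s' k) (cSrc (x, 1)) - 𝓕.obs Ω (s' k) (cSrc (x, 0))‖ ≤ L * s' k * Real.sqrt (s' k)) ∧
      (∀ x : Site 2, meshPoint (s' k) x ∈ K → ∀ i : Fin 4, (i = 0 ∨ i = 1) → ‖𝓕.obs Ω (s' k) (cSrc (x, i))‖ ≤ M * Real.sqrt (s' k))) ∧
      (∀ y : Site 2, meshPoint (s' k) y ∈ K → ∀ e : Fin 4, 𝓕.Hw (s' k) (y + cornerUnit e) - 𝓕.Hw (s' k) y =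
        -(1 / (Real.sqrt 2 * kcFluxConst)) * (I ^ (e : ℕ) * ((1 : ℂ) * 𝓕.obs Ω (s' k) (cSrc (y, e))) ^ 2).im)) ∧
      (s' k < r / 3 ∧ 0 < s' k) := fun k => hk₀ (k + k₀) (Nat.le_add_left _ _)
  have hs'0 : ∀ k, 0 < s' k := fun k => (hk k).2.2
  have hs'lim : Tendsto s' atTop (𝓝 0) := (hs.mono_right nhdsWithin_le_nhds).comp (tendsto_add_atTop_nat k₀)
  have hconv' : TendstoUniformlyOn (scaledEdgeFamily (𝓕.obs Ω) s') g atTop K := tendstoUniformlyOn_shift hconv k₀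
  have core := tendsto_staircase_of_increments (Fm := 𝓕.obs Ω) hs'0 hs'lim hre him hK hg hr hKR hconv'
    (fun k => by have := (hk k).2.1; linarith) (fun k x hx => (hk k).1.1.1 x hx) (fun k x hx i hi => (hk k).1.1.2 x hx i hi)
    (fun k => 𝓕.Hw (s' k)) (κ := 1 / (Real.sqrt 2 * kcFluxConst)) (θ₀ := 1) (fun k y hy e => (hk k).1.2 y hy e)
  rw [hs'] at core
  exact (tendsto_add_atTop_iff_nat (f := fun k => 𝓕.Hw (s k) (vtx (nearestSite (s k) z) (⌊(w.re - z.re) / s k⌋₊)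
    (⌊(w.im - z.im) / s k⌋₊)) - 𝓕.Hw (s k) (nearestSite (s k) z)) k₀).1 core

end KCFamily

end Literature.Probability.LatticeModels
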